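import Summits.BirchSwinnertonDyer.Rank1Residual.Iwasawa.LocalTowerKernelNumericTest
import Summits.BirchSwinnertonDyer.Rank1Residual.Additive.LocalTowerKernelAtPOfStableSubgroup
import Literature.NumberTheory.EllipticCurves.PadicPointsFiniteIndexProofs
import Literature.Barriers.BirchSwinnertonDyer.RankNotSumOfLocalInvariantsF3
import HarnessLib

/-!
# The three fixed-point facts of `E(K̄_v)` at `v ∣ p` for EVERY reduction type — from
# `E(ℚ_p) ⊇ (finite index) ≅ ℤ_p` (Silverman VII.6.3, a tree THEOREM) — and the local tower kernel
# END along a stable subgroup WITHOUT a reduction-type hypothesis (team n1011, row T-T3M, seat p12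
# GEN 9; file F7-M: reduction-type-free replacement of p07's ADDITIVE FixedLevel engine in F2-M)

HONEST FRAMING (cell `b2b-bsdres`, run/shared/lean/b2b/bsd-rank1-residual/, verbatim in every
file): the goal of the cell is to DELETE the COMBINATION-SHAPED residual classes of the
Birch–Swinnerton-Dyer formula for ALL analytic-rank `≤ 1` elliptic curves over `ℚ` — "full BSD
formula for every rank `≤ 1` curve in class `C`" assembled STRICTLY from published theorems — so
that the rank-`≤ 1` remainder becomes exactly the CONSTRUCTION-SHAPED classes, which are TYPED
(missing-input `Prop`s), NOT attempted. This is not "finishing BSD". Team n1011 (N10/N11; row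
T-T3M, skeleton `cells/n1011/skel/T-T3M.md`): research routes on CONSTRUCTION-SHAPED classes; prove
what is provable now; no claim beyond stated classes; census output = EVIDENCE, never a Literature
fact; RESIDUAL-MAP marks UNCHANGED; nothing is booked by this file. TOOL THEOREMS ONLY: no
definition, no named fact (the input "`E(ℚ_p)` has a finite-index subgroup `≅ ℤ_p`" is the tree
THEOREM `exists_finiteIndex_addEquiv_padicInt_holds`, Silverman *AEC* VII.6.3).

## What

F2-M (`Additive/LocalTowerKernelAtPOfStableSubgroup`) reduced Greenberg's level-`0` local tower
kernel at `v ∋ p` along a stable subgroup `A₁ ≤ E(K̄_v)` to two facts about `Γ_{ℚ_v}`-FIXED points —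
(a) one `N > 0` kills every fixed torsion point, (b) a point `pⁿ`-divisible modulo fixed torsion by
fixed points for every `n` is torsion, plus (c) a fixed point of infinite order — and discharged
them at an ADDITIVE place from p07's FixedLevel engine. THIS FILE proves (a), (b), (c) for EVERY
elliptic `W/ℚ` at EVERY place `v ∋ p`, whatever the reduction type: the fixed points are the
`ℚ_v`-rational points (Galois descent, p06's `exists_eq_baseChange_of_forall_smul_eq` and the tree's
`fixedPoints_eq_range_map_holds`), `E(ℚ_v) ≅ E(ℚ_p)` along Mathlib's `adicCompletion.padicEquiv`
(tree `pointEquivOfAlgEquiv`), and `E(ℚ_p)` has a finite-index subgroup `A ≅ ℤ_p` (tree theorem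
`exists_finiteIndex_addEquiv_padicInt_holds`, *AEC* VII.6.3): the index `[E(ℚ_p) : A]` kills every
torsion point (`ℤ_p` is torsion-free), `⋂ₙ pⁿ ℤ_p = 0` gives (b), and `A ∋` a point of infinite order.

* §1 `facts_of_finiteIndex_addEquiv_padicInt` — the abelian-group lemma;
* §2 `FixedPointFacts.exists_nsmul_eq_zero_of_fixed_of_isOfFinAddOrder (hpv)`,
  `….isOfFinAddOrder_of_forall_exists_fixed (hpv)`, `….exists_fixed_not_isOfFinAddOrder (hpv)` —
  p07's three FixedLevel exports with the hypothesis `W.HasAdditiveReductionAt v` REMOVED;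
* §3 `StableSubgroupLine.localTowerKerPrimary_zero_eq_bot_of_stableSubgroup_anyReduction (hpv) (κ)
  (A₁) (hA₁) (hdiv₁) (htor) (hP₁) (hP₁ord) (hK) (hmove)` — F2-M's END with `hadd` REMOVED (the core
  `…_of_facts` fed by §2): the Greenberg Lemma-3.4 dévissage at `v ∋ p` for ANY reduction type,
  given a stable `p`-divisible `A₁` with torsion quotient, cyclic `A₁[p]` and a moving element of
  `(ker κ)_v` — the input for the non-split MULTIPLICATIVE sibling of T-T3M (Greenberg LNM 1716
  p. 93; Delbourgo 1998 §2.2 Lemma (ii), second half), not claimed here.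

References: [SilvermanAEC2009] J. H. Silverman, *AEC* 2nd ed., VII.6.3, VIII.§1 (Galois descent);
[GreenbergLNM1716] §3 Lemma 3.4 (p. 89), p. 93; cells/n1011/skel/T-T3M.md §5.
-/

noncomputable section

open scoped Classical NumberField

universe u

namespace Summit.BirchSwinnertonDyer.Rank1Residual.Iwasawa.FixedPointFacts

open NumberField IsDedekindDomain Field IsDedekindDomain.HeightOneSpectrum WeierstrassCurve
  Literature.NumberTheory.EllipticCurves Literature.NumberTheory.GaloisRepresentations
  Rat.HeightOneSpectrum Summit.BirchSwinnertonDyer.Rank1Residual.X11b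
  Literature.Barriers.BirchSwinnertonDyer

/-! ## §1 Abelian groups with a finite-index subgroup `≅ ℤ_p` -/

/-- **Torsion, divisibility and rank in a group with a finite-index subgroup `A ≅ ℤ_p`.** For an
abelian group `G` and `A ≤ G` of finite index with `A ≃+ ℤ_p`: (a) `[G : A] • x = 0` for every
torsion `x` (`[G:A] • x ∈ A ≅ ℤ_p`, torsion-free); (b) an `x` with `x = pⁿ • cₙ + tₙ`, `tₙ` torsion,
for every `n` is torsion (`[G:A] • x ∈ ⋂ₙ pⁿ A = 0`); (c) `G` has an element of infinite order.
[cite: SilvermanAEC2009, VII.6.3] -/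
theorem facts_of_finiteIndex_addEquiv_padicInt {p : ℕ} [hp : Fact p.Prime] {G : Type*}
    [AddCommGroup G] {A : AddSubgroup G} (hA : A.FiniteIndex) (e : A ≃+ ℤ_[p]) :
    (∀ x : G, IsOfFinAddOrder x → A.index • x = 0) ∧
    (∀ x : G, (∀ n : ℕ, ∃ c t : G, IsOfFinAddOrder t ∧ x = p ^ n • c + t) → IsOfFinAddOrder x) ∧
    (∃ u : G, ¬ IsOfFinAddOrder u) := by
  have hidx : 0 < A.index := Nat.pos_of_ne_zero hA.index_ne_zero
  -- an element of `ℤ_p` of finite additive order is `0`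
  have hZp : ∀ z : ℤ_[p], IsOfFinAddOrder z → z = 0 := by
    intro z hz
    obtain ⟨n, hn, hnz⟩ := isOfFinAddOrder_iff_nsmul_eq_zero.mp hz
    rw [nsmul_eq_mul] at hnz
    exact (mul_eq_zero.mp hnz).resolve_left (Nat.cast_ne_zero.mpr hn.ne')
  -- (a)
  have ha : ∀ x : G, IsOfFinAddOrder x → A.index • x = 0 := by
    intro x hx
    have hmem : A.index • x ∈ A := AddSubgroup.nsmul_index_mem A x
    have htor : IsOfFinAddOrder (⟨A.index • x, hmem⟩ : A) := by
      obtain ⟨n, hn, hnx⟩ := isOfFinAddOrder_iff_nsmul_eq_zero.mp hx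
      refine isOfFinAddOrder_iff_nsmul_eq_zero.mpr ⟨n, hn, Subtype.ext ?_⟩
      change n • (A.index • x) = 0
      rw [smul_comm, hnx, smul_zero]
    have h0 : (⟨A.index • x, hmem⟩ : A) = 0 :=
      e.injective (by rw [map_zero]; exact hZp _ (e.toAddMonoidHom.isOfFinAddOrder htor))
    exact congrArg Subtype.val h0
  refine ⟨ha, fun x hx ↦ ?_, ?_⟩
  · -- (b): `[G:A] • x` is `pⁿ`-divisible inside `A ≅ ℤ_p` for every `n`
    have hmem : A.index • x ∈ A := AddSubgroup.nsmul_index_mem A x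
    have hdiv : ∀ n : ℕ, ∃ b : A, (⟨A.index • x, hmem⟩ : A) = p ^ n • b := by
      intro n
      obtain ⟨c, t, ht, hxe⟩ := hx n
      refine ⟨⟨A.index • c, AddSubgroup.nsmul_index_mem A c⟩, Subtype.ext ?_⟩
      change A.index • x = p ^ n • (A.index • c)
      rw [hxe, smul_add, ha t ht, add_zero, smul_comm]
    have hz : e ⟨A.index • x, hmem⟩ = 0 := by
      have hnorm : ∀ n : ℕ, 1 ≤ n → ‖((e ⟨A.index • x, hmem⟩ : ℤ_[p]) : ℚ_[p])‖ ≤ ((p : ℝ)⁻¹) ^ n := by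
        intro n _
        obtain ⟨b, hb⟩ := hdiv n
        rw [hb, map_nsmul, nsmul_eq_mul, PadicInt.coe_mul, norm_mul, PadicInt.coe_natCast,
          Nat.cast_pow, norm_pow, Padic.norm_p, inv_pow]
        exact mul_le_of_le_one_right (by positivity) (PadicInt.norm_le_one _)
      exact PadicInt.coe_eq_zero.mp (padic_eq_zero_of_norm_le_p_pow hnorm)
    have h0 : (⟨A.index • x, hmem⟩ : A) = 0 := e.injective (by rw [hz, map_zero])
    exact isOfFinAddOrder_iff_nsmul_eq_zero.mpr ⟨A.index, hidx, congrArg Subtype.val h0⟩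
  · -- (c): the preimage of `1 ∈ ℤ_p`
    refine ⟨((e.symm 1 : A) : G), fun hu ↦ ?_⟩
    obtain ⟨n, hn, hnu⟩ := isOfFinAddOrder_iff_nsmul_eq_zero.mp hu
    have h1 : n • (e.symm 1) = 0 := Subtype.ext (by
      rw [AddSubgroupClass.coe_nsmul]; exact hnu)
    have h2 : (n : ℤ_[p]) = 0 := by
      have := congrArg e h1
      rwa [map_nsmul, AddEquiv.apply_symm_apply, map_zero, nsmul_eq_mul, mul_one] at this
    exact hn.ne' (Nat.cast_eq_zero.mp h2)

/-! ## §2 The fixed points of `E(K̄_v)` = `E(ℚ_v) ≅ E(ℚ_p)`: the three facts, any reduction type -/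

section Local

variable (W : WeierstrassCurve ℚ) [W.IsElliptic] (p : ℕ) [hp : Fact p.Prime]
  {v : HeightOneSpectrum (𝓞 ℚ)}

/-- **The rational points inside `E(K̄_v)` and their three properties.** At `v ∋ p` there is an
injective additive map `ι : E(ℚ_v) → E(K̄_v)` (base change along `ℚ_v → K̄_v`, through the identity
transports of p06's `exists_eq_baseChange_of_forall_smul_eq`) whose image is EXACTLY the set of
`Γ_{ℚ_v}`-fixed points (Galois descent, tree `fixedPoints_eq_range_map_holds`), and `E(ℚ_v)` has a
finite-index subgroup `≅ ℤ_p` (`E(ℚ_v) ≅ E(ℚ_p)` by `pointEquivOfAlgEquiv` along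
`adicCompletion.padicEquiv`; *AEC* VII.6.3 = tree `exists_finiteIndex_addEquiv_padicInt_holds`).
[cite: SilvermanAEC2009, VII.6.3 and VIII.§1] -/
theorem exists_rationalPoints_hom (hpv : ((p : ℕ) : 𝓞 ℚ) ∈ v.asIdeal) :
    ∃ ι : (W.baseChange (v.adicCompletion ℚ)).toAffine.Point →+ localPoints W (v.adicCompletion ℚ),
      Function.Injective ι ∧
      (∀ P₀, ∀ σ : absoluteGaloisGroup (v.adicCompletion ℚ), σ • ι P₀ = ι P₀) ∧
      (∀ P : localPoints W (v.adicCompletion ℚ),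
        (∀ σ : absoluteGaloisGroup (v.adicCompletion ℚ), σ • P = P) → ∃ P₀, ι P₀ = P) ∧
      ∃ A : AddSubgroup (W.baseChange (v.adicCompletion ℚ)).toAffine.Point,
        A.FiniteIndex ∧ Nonempty (A ≃+ ℤ_[p]) := by
  -- the map, on the underlying point groups, then viewed on `localPoints`
  let ι₀ : (W.baseChange (v.adicCompletion ℚ)).toAffine.Point →+
      (W.baseChange (AlgebraicClosure (v.adicCompletion ℚ))).toAffine.Point :=
    (Affine.Point.congrEquiv (baseChange_baseChange_adicCompletion W v)).toAddMonoidHom.comp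
      ((Affine.Point.baseChange (W' := W.baseChange (v.adicCompletion ℚ))
          (v.adicCompletion ℚ) (AlgebraicClosure (v.adicCompletion ℚ))).comp
        (Affine.Point.congrEquiv (baseChange_baseChange_self W v).symm).toAddMonoidHom)
  let ι : (W.baseChange (v.adicCompletion ℚ)).toAffine.Point →+ localPoints W (v.adicCompletion ℚ) :=
    { toFun := fun P₀ ↦ (show localPoints W (v.adicCompletion ℚ) from ι₀ P₀)
      map_zero' := ι₀.map_zero
      map_add' := fun a b ↦ ι₀.map_add a b }
  have hι : ∀ P₀, ι P₀ = Affine.Point.congrEquiv (baseChange_baseChange_adicCompletion W v)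
      (Affine.Point.baseChange (W' := W.baseChange (v.adicCompletion ℚ))
        (v.adicCompletion ℚ) (AlgebraicClosure (v.adicCompletion ℚ))
        (Affine.Point.congrEquiv (baseChange_baseChange_self W v).symm P₀)) := fun _ ↦ rfl
  refine ⟨ι, ?_, ?_, ?_, ?_⟩
  · -- injective
    intro P Q h
    rw [hι, hι] at h
    exact (Affine.Point.congrEquiv _).injective (Affine.Point.map_injective
      (Algebra.ofId (v.adicCompletion ℚ) (AlgebraicClosure (v.adicCompletion ℚ)))
        ((Affine.Point.congrEquiv _).injective h))
  · -- rational points are fixed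
    intro P₀ σ
    set Q : geomPoints (W.baseChange (v.adicCompletion ℚ)) :=
      Affine.Point.baseChange (W' := W.baseChange (v.adicCompletion ℚ))
        (v.adicCompletion ℚ) (AlgebraicClosure (v.adicCompletion ℚ))
        (Affine.Point.congrEquiv (baseChange_baseChange_self W v).symm P₀) with hQ
    -- `σ` (a `ℚ_v`-algebra map of `K̄_v`) fixes the base change of a `ℚ_v`-rational point
    have hσQ : Affine.Point.map ((absoluteGaloisGroup.toAlgEquiv _ σ :
        AlgebraicClosure (v.adicCompletion ℚ) ≃ₐ[v.adicCompletion ℚ]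
          AlgebraicClosure (v.adicCompletion ℚ)) :
        AlgebraicClosure (v.adicCompletion ℚ) →ₐ[v.adicCompletion ℚ]
          AlgebraicClosure (v.adicCompletion ℚ)) Q = Q := by
      rw [hQ]
      exact Affine.Point.map_baseChange _ _
    apply (Affine.Point.congrEquiv (baseChange_baseChange_adicCompletion W v).symm).injective
    rw [congrEquiv_smul, hι, ← hQ, LocalPurity.congrEquiv_symm_apply_congrEquiv, hσQ]
  · -- fixed points are rational
    intro P hP
    obtain ⟨P₀, hP₀⟩ := exists_eq_baseChange_of_forall_smul_eq W v P hP
    exact ⟨P₀, by rw [hι]; exact hP₀⟩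
  · -- `E(ℚ_v) ≅ E(ℚ_p) ⊇ A ≅ ℤ_p` of finite index
    have hvp : (primesEquiv v : ℕ) = p := primesEquiv_eq_of_natCast_mem v hp.out hpv
    subst hvp
    exact exists_finiteIndex_addEquiv_of_addEquiv
      (pointEquivOfAlgEquiv W (adicCompletion.padicEquiv v).toAlgEquiv)
      (exists_finiteIndex_addEquiv_padicInt_holds (primesEquiv v : ℕ)
        (W.baseChange ℚ_[(primesEquiv v : ℕ)]))

/-- **(a) ONE `N > 0` kills every `Γ_{ℚ_v}`-fixed torsion point of `E(K̄_v)`**, at any `v ∋ p`, ANY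
reduction type (`N = [E(ℚ_p) : A]` for a finite-index `A ≅ ℤ_p`). p07's
`FixedLevel.exists_nsmul_eq_zero_of_fixed_of_isOfFinAddOrder` without `HasAdditiveReductionAt`.
[cite: SilvermanAEC2009, VII.6.3] -/
theorem exists_nsmul_eq_zero_of_fixed_of_isOfFinAddOrder (hpv : ((p : ℕ) : 𝓞 ℚ) ∈ v.asIdeal) :
    ∃ N : ℕ, 0 < N ∧ ∀ R : localPoints W (v.adicCompletion ℚ),
      (∀ σ : absoluteGaloisGroup (v.adicCompletion ℚ), σ • R = R) → IsOfFinAddOrder R → N • R = 0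
          := by
  obtain ⟨ι, hinj, -, hsurj, A, hA, ⟨e⟩⟩ := exists_rationalPoints_hom W p hpv
  obtain ⟨ha, -, -⟩ := facts_of_finiteIndex_addEquiv_padicInt hA e
  refine ⟨A.index, Nat.pos_of_ne_zero hA.index_ne_zero, fun R hR hRtor ↦ ?_⟩
  obtain ⟨P₀, rfl⟩ := hsurj R hR
  rw [← map_nsmul, ha P₀ (hinj.isOfFinAddOrder_iff.mp hRtor), map_zero]

/-- **(b) A point `pⁿ`-divisible modulo fixed torsion by fixed points for EVERY `n` is torsion**, at
any `v ∋ p`, ANY reduction type (`⋂ₙ pⁿ ℤ_p = 0`). p07's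
`FixedLevel.isOfFinAddOrder_of_forall_exists_fixed` without `HasAdditiveReductionAt`.
[cite: SilvermanAEC2009, VII.6.3] -/
theorem isOfFinAddOrder_of_forall_exists_fixed (hpv : ((p : ℕ) : 𝓞 ℚ) ∈ v.asIdeal)
    {R : localPoints W (v.adicCompletion ℚ)}
    (h : ∀ n : ℕ, ∃ c t : localPoints W (v.adicCompletion ℚ),
      (∀ σ : absoluteGaloisGroup (v.adicCompletion ℚ), σ • c = c) ∧
      (∀ σ : absoluteGaloisGroup (v.adicCompletion ℚ), σ • t = t) ∧ IsOfFinAddOrder t ∧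
      R = p ^ n • c + t) :
    IsOfFinAddOrder R := by
  obtain ⟨ι, hinj, -, hsurj, A, hA, ⟨e⟩⟩ := exists_rationalPoints_hom W p hpv
  obtain ⟨-, hb, -⟩ := facts_of_finiteIndex_addEquiv_padicInt hA e
  -- `R` itself is fixed (`n = 0`), hence rational
  have hRfix : ∀ σ : absoluteGaloisGroup (v.adicCompletion ℚ), σ • R = R := by
    obtain ⟨c, t, hc, ht, -, hR⟩ := h 0
    intro σ
    rw [hR, smul_add, smul_comm, hc σ, ht σ]
  obtain ⟨R₀, rfl⟩ := hsurj R hRfix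
  refine hinj.isOfFinAddOrder_iff.mpr (hb R₀ fun n ↦ ?_)
  obtain ⟨c, t, hc, ht, httor, hR⟩ := h n
  obtain ⟨c₀, rfl⟩ := hsurj c hc
  obtain ⟨t₀, rfl⟩ := hsurj t ht
  refine ⟨c₀, t₀, hinj.isOfFinAddOrder_iff.mp httor, hinj ?_⟩
  rw [hR, map_add, map_nsmul]

/-- **(c) A `Γ_{ℚ_v}`-fixed point of `E(K̄_v)` of infinite order exists**, at any `v ∋ p`, ANY
reduction type (a generator of `A ≅ ℤ_p`). p07's `FixedLevel.exists_fixed_not_isOfFinAddOrder`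
without `HasAdditiveReductionAt`. [cite: SilvermanAEC2009, VII.6.3] -/
theorem exists_fixed_not_isOfFinAddOrder (hpv : ((p : ℕ) : 𝓞 ℚ) ∈ v.asIdeal) :
    ∃ u : localPoints W (v.adicCompletion ℚ),
      (∀ σ : absoluteGaloisGroup (v.adicCompletion ℚ), σ • u = u) ∧ ¬ IsOfFinAddOrder u := by
  obtain ⟨ι, hinj, hfix, -, A, hA, ⟨e⟩⟩ := exists_rationalPoints_hom W p hpv
  obtain ⟨-, -, u₀, hu₀⟩ := facts_of_finiteIndex_addEquiv_padicInt hA e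
  exact ⟨ι u₀, hfix u₀, fun h ↦ hu₀ (hinj.isOfFinAddOrder_iff.mp h)⟩

end Local

end Summit.BirchSwinnertonDyer.Rank1Residual.Iwasawa.FixedPointFacts

/-! ## §3 The local tower kernel END along a stable subgroup, ANY reduction type -/

namespace Summit.BirchSwinnertonDyer.Rank1Residual.Additive.StableSubgroupLine

open NumberField IsDedekindDomain Field IsDedekindDomain.HeightOneSpectrum WeierstrassCurve
  Literature.NumberTheory.EllipticCurves Literature.NumberTheory.GaloisRepresentations
  Summit.BirchSwinnertonDyer.Rank1Residual.Iwasawa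

variable (W : WeierstrassCurve ℚ) [W.IsElliptic] (p : ℕ) [hp : Fact p.Prime]
  {v : HeightOneSpectrum (𝓞 ℚ)}

set_option maxHeartbeats 400000 in
/-- **`𝒦_{v,0}[p^∞] = 0` at `v ∋ p` along ANY `Γ_{ℚ_v}`-stable `p`-divisible subgroup with torsion
quotient, cyclic `A₁[p]` and a moving element of `(ker κ)_v` — NO reduction-type hypothesis**:
F2-M's core `localTowerKerPrimary_zero_eq_bot_of_stableSubgroup_of_facts` with the fixed-point facts
(a)–(c) of §2 (any reduction type). F2-M's additive corollary is the special case; the non-split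
multiplicative sibling of T-T3M (Greenberg LNM 1716 p. 93) would feed this with `A₁ = Ψ(𝒪̄ˣ)` of the
curve's own Tate parametrisation (not claimed here).
[cite: GreenbergLNM1716, §3 Lemma 3.4 (p. 89) and p. 93] [cite: SilvermanAEC2009, VII.6.3] -/
theorem localTowerKerPrimary_zero_eq_bot_of_stableSubgroup_anyReduction
    (hpv : ((p : ℕ) : 𝓞 ℚ) ∈ v.asIdeal) (κ : ZpExtension ℚ p)
    (A₁ : AddSubgroup (localPoints W (v.adicCompletion ℚ)))
    (hA₁ : ∀ (σ : absoluteGaloisGroup (v.adicCompletion ℚ)) (a : localPoints W (v.adicCompletion ℚ)),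
      a ∈ A₁ → σ • a ∈ A₁)
    (hdiv₁ : ∀ a ∈ A₁, ∃ b ∈ A₁, p • b = a)
    (htor : ∀ a : localPoints W (v.adicCompletion ℚ), ∃ n : ℕ, 0 < n ∧ n • a ∈ A₁)
    {P₁ : localPoints W (v.adicCompletion ℚ)} (hP₁ : P₁ ∈ A₁) (hP₁ord : addOrderOf P₁ = p)
    (hK : ∀ P ∈ A₁, p • P = 0 → ∃ c : ℕ, P = c • P₁)
    (hmove : ∃ σ ∈ localSubgroup κ.kerSubgroup (v.adicCompletion ℚ),
      ∃ P : localPoints W (v.adicCompletion ℚ), p • P = 0 ∧ σ • P - P ∉ A₁) :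
    W.localTowerKerPrimary κ (v.adicCompletion ℚ) 0 = ⊥ := by
  obtain ⟨u, hu₁, huG, hu⟩ := exists_fixed_mem_not_pdivisible_of_facts W p
    (fun _ h ↦ FixedPointFacts.isOfFinAddOrder_of_forall_exists_fixed W p hpv h)
    (FixedPointFacts.exists_fixed_not_isOfFinAddOrder W p hpv) A₁ htor
  exact localTowerKerPrimary_zero_eq_bot_of_stableSubgroup_of_facts W p hpv κ A₁
    (finite_fixed_primary_mem_of_kill W p
      (FixedPointFacts.exists_nsmul_eq_zero_of_fixed_of_isOfFinAddOrder W p hpv) A₁)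
    hu₁ huG hu hA₁ hdiv₁ htor hP₁ hP₁ord hK hmove

end Summit.BirchSwinnertonDyer.Rank1Residual.Additive.StableSubgroupLine

end
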